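import Literature.Geometry.Riemannian.RicciFlowHeatKernel
import HarnessLib

/-!
# The heat kernel function `K(x,t;y,s)` of a Ricci flow as a definition, with its API
# (Bamler 2020a, §2.3)

R. Bamler, *Entropy and heat kernel bounds on a Ricci flow background*, arXiv:2008.07093 (2020a),
§2.3. `RicciFlowHeatKernel.lean` proves the EXISTENCE of a heat kernel function with all its
properties (`IsRicciFlow.exists_heatKernelFn`). This file names a choice of it,

* `IsRicciFlow.heatKernelFn hflow hh hR : ℝ → M → M × ℝ → ℝ`,
  `hflow.heatKernelFn hh hR t x (y, s) = K(x,t;y,s)`, for a Ricci flow `hflow` on `[a, T]` of a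
  `C^∞` family `hh` of Riemannian metrics `hR` on a closed connected manifold,

and unpacks the API: smoothness and positivity in `(y, s)` (`heatKernelFn_contMDiffOn`,
`heatKernelFn_pos`), the density property (`heatKernelMeasure_eq_withDensity_heatKernelFn`,
`integral_eq_integral_mul_heatKernelFn`, `integral_heatKernelFn_eq_one`), the conjugate heat
equation (`deriv_heatKernelFn_time`), the Lipschitz bound and continuity in the base point
(`heatKernelFn_lipschitz_basePoint`, `continuousOn_heatKernelFn`,
`continuousOn_heatKernelFn_basePoint`), smoothness and the heat equation in the base point
(`contMDiffOn_heatKernelFn_basePoint`, `deriv_heatKernelFn_basePoint`) and the reproduction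
formulas (`heatKernelFn_reproduction`, `heatKernelFn_semigroup`).

The only definition is `IsRicciFlow.heatKernelFn` (a `Classical.choose`); no named facts.

## References

* R. H. Bamler, *Entropy and heat kernel bounds on a Ricci flow background*, arXiv:2008.07093
  (2020), §2.3, Def. 1. [Bamler2020Entropy]
-/

noncomputable section

open Bundle Set Function Filter Manifold MeasureTheory Measure TopologicalSpace
open scoped Manifold ContDiff Topology ENNReal NNReal

namespace Literature.Geometry.Riemannian

open Lorentzian Lorentzian.PseudoRiemannianMetric

section HeatKernelFnDef

variable {m : ℕ} {H : Type*} [TopologicalSpace H]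
  {I : ModelWithCorners ℝ (EuclideanSpace ℝ (Fin m)) H} [I.Boundaryless]
  {M : Type*} [TopologicalSpace M] [ChartedSpace H M] [IsManifold I ∞ M]
  [T2Space M] [CompactSpace M] [SecondCountableTopology M] [MeasurableSpace M] [BorelSpace M]
  [PreconnectedSpace M]
  {h : ℝ → PseudoRiemannianMetric I ∞ (EuclideanSpace ℝ (Fin m)) (TangentSpace I : M → Type _)}
  {cov : ℝ → CovariantDerivative I (EuclideanSpace ℝ (Fin m)) (TangentSpace I : M → Type _)}
  {a T : ℝ}

/-- **The heat kernel function of a Ricci flow on a closed connected manifold** (Bamler 2020a,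
§2.3, `K(x,t;y,s)`; Def. 1, `dν_{x,t;s} = K(x,t;·,s) dg_s`): for a Ricci flow `hflow = (h, cov)` on
`[a, T]` of a `C^∞` family of Riemannian metrics on the closed connected manifold `M`,
`hflow.heatKernelFn hh hR t x (y, s) = K(x,t;y,s)` — a choice of the function of
`IsRicciFlow.exists_heatKernelFn` (unique on its natural domain `a < s < t ≤ T` as the continuous
density of `ν_{x,t;s}`; junk elsewhere). [cite: Bamler2020Entropy, §2.3, Def. 1] -/
def IsRicciFlow.heatKernelFn (hflow : IsRicciFlow h cov (Icc a T)) (hh : IsContMDiffFamilyOn ∞ h univ)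
    (hR : ∀ r, (h r).IsRiemannian) : ℝ → M → M × ℝ → ℝ :=
  Classical.choose (hflow.exists_heatKernelFn hh hR)

variable (hflow : IsRicciFlow h cov (Icc a T)) (hh : IsContMDiffFamilyOn ∞ h univ)
  (hR : ∀ r, (h r).IsRiemannian)

/-- The defining properties of `heatKernelFn` (`IsRicciFlow.exists_heatKernelFn`).
[cite: Bamler2020Entropy, §2.3] -/
theorem IsRicciFlow.heatKernelFn_spec :
    (∀ t ∈ Ioc a T,
        (∀ x, ContMDiffOn (I.prod 𝓘(ℝ, ℝ)) 𝓘(ℝ, ℝ) ∞ (hflow.heatKernelFn hh hR t x) (univ ×ˢ Ioo a t)) ∧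
        (∀ x, ∀ p ∈ univ ×ˢ Ioo a t, 0 < hflow.heatKernelFn hh hR t x p) ∧
        (∀ x, ∀ s ∈ Ioo a t, heatKernelMeasure hh hR t x s =
          (h s).riemVolume.withDensity fun y ↦ ENNReal.ofReal (hflow.heatKernelFn hh hR t x (y, s))) ∧
        (∀ x, ∀ p ∈ univ ×ˢ Ioo a t, deriv (fun s ↦ hflow.heatKernelFn hh hR t x (p.1, s)) p.2 =
          -(h p.2).laplaceBeltrami (fun y ↦ hflow.heatKernelFn hh hR t x (y, p.2)) p.1 +
            (h p.2).scalarCurvatureWith (cov p.2) p.1 * hflow.heatKernelFn hh hR t x p) ∧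
        (∀ a' b', a < a' → a' < b' → b' < t → ∃ L : ℝ, ∀ (x x' : M), ∀ p ∈ univ ×ˢ Icc a' b',
          ENNReal.ofReal |hflow.heatKernelFn hh hR t x p - hflow.heatKernelFn hh hR t x' p| ≤
            ENNReal.ofReal L * (h t).edist (hR t) x x') ∧
        ContinuousOn (fun q : M × (M × ℝ) ↦ hflow.heatKernelFn hh hR t q.1 q.2)
          (univ ×ˢ (univ ×ˢ Ioo a t))) ∧
      (∀ s ∈ Ioo a T, ∀ y,
        ContMDiffOn (I.prod 𝓘(ℝ, ℝ)) 𝓘(ℝ, ℝ) ∞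
          (fun p : M × ℝ ↦ hflow.heatKernelFn hh hR p.2 p.1 (y, s)) (univ ×ˢ Ioo s T) ∧
        ∀ p ∈ (univ : Set M) ×ˢ Ioo s T, deriv (fun t ↦ hflow.heatKernelFn hh hR t p.1 (y, s)) p.2 =
          (h p.2).laplaceBeltrami (fun x ↦ hflow.heatKernelFn hh hR p.2 x (y, s)) p.1) ∧
      (∀ s ∈ Ioo a T, ContinuousOn
        (fun q : (M × ℝ) × M ↦ hflow.heatKernelFn hh hR q.1.2 q.1.1 (q.2, s))
        ((univ ×ˢ Ioc s T) ×ˢ univ)) ∧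
      (∀ r t, a < r → r < t → t ≤ T → ∀ x, ∀ s ∈ Ioo a r, ∀ y,
        hflow.heatKernelFn hh hR t x (y, s) =
            ∫ z, hflow.heatKernelFn hh hR r z (y, s) ∂(heatKernelMeasure hh hR t x r) ∧
          hflow.heatKernelFn hh hR t x (y, s) =
            ∫ z, hflow.heatKernelFn hh hR t x (z, r) * hflow.heatKernelFn hh hR r z (y, s)
              ∂(h r).riemVolume) :=
  Classical.choose_spec (hflow.exists_heatKernelFn hh hR)

/-- `K(x,t;·,·)` is `C^∞` on `M × (a, t)`. [cite: Bamler2020Entropy, §2.3] -/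
theorem IsRicciFlow.heatKernelFn_contMDiffOn {t : ℝ} (ht : t ∈ Ioc a T) (x : M) :
    ContMDiffOn (I.prod 𝓘(ℝ, ℝ)) 𝓘(ℝ, ℝ) ∞ (hflow.heatKernelFn hh hR t x) (univ ×ˢ Ioo a t) :=
  ((hflow.heatKernelFn_spec hh hR).1 t ht).1 x

/-- `K(x,t;y,s) > 0` for `a < s < t ≤ T`. [cite: Bamler2020Entropy, §2.3] -/
theorem IsRicciFlow.heatKernelFn_pos {t : ℝ} (ht : t ∈ Ioc a T) (x : M) {p : M × ℝ}
    (hp : p ∈ univ ×ˢ Ioo a t) : 0 < hflow.heatKernelFn hh hR t x p :=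
  ((hflow.heatKernelFn_spec hh hR).1 t ht).2.1 x p hp

/-- `dν_{x,t;s} = K(x,t;·,s) dV_{h(s)}` (Bamler 2020a, Def. 1). [cite: Bamler2020Entropy, §2.3, Def. 1] -/
theorem IsRicciFlow.heatKernelMeasure_eq_withDensity_heatKernelFn {t : ℝ} (ht : t ∈ Ioc a T) (x : M)
    {s : ℝ} (hs : s ∈ Ioo a t) :
    heatKernelMeasure hh hR t x s =
      (h s).riemVolume.withDensity fun y ↦ ENNReal.ofReal (hflow.heatKernelFn hh hR t x (y, s)) :=
  ((hflow.heatKernelFn_spec hh hR).1 t ht).2.2.1 x s hs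

/-- The conjugate heat equation `∂ₛK = −Δ_{y,h(s)}K + R K` in `(y, s)`. [cite: Bamler2020Entropy, §2.3] -/
theorem IsRicciFlow.deriv_heatKernelFn_time {t : ℝ} (ht : t ∈ Ioc a T) (x : M) {p : M × ℝ}
    (hp : p ∈ univ ×ˢ Ioo a t) :
    deriv (fun s ↦ hflow.heatKernelFn hh hR t x (p.1, s)) p.2 =
      -(h p.2).laplaceBeltrami (fun y ↦ hflow.heatKernelFn hh hR t x (y, p.2)) p.1 +
        (h p.2).scalarCurvatureWith (cov p.2) p.1 * hflow.heatKernelFn hh hR t x p :=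
  ((hflow.heatKernelFn_spec hh hR).1 t ht).2.2.2.1 x p hp

/-- `K(·,t;y,s)` is Lipschitz for `d_{h(t)}`, uniformly for `(y, s)` in compact sub-slabs.
[cite: Bamler2020Entropy, §2.3] -/
theorem IsRicciFlow.heatKernelFn_lipschitz_basePoint {t : ℝ} (ht : t ∈ Ioc a T) {a' b' : ℝ}
    (haa' : a < a') (ha'b' : a' < b') (hb't : b' < t) :
    ∃ L : ℝ, ∀ (x x' : M), ∀ p ∈ univ ×ˢ Icc a' b',
      ENNReal.ofReal |hflow.heatKernelFn hh hR t x p - hflow.heatKernelFn hh hR t x' p| ≤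
        ENNReal.ofReal L * (h t).edist (hR t) x x' :=
  ((hflow.heatKernelFn_spec hh hR).1 t ht).2.2.2.2.1 a' b' haa' ha'b' hb't

/-- `(x, y, s) ↦ K(x,t;y,s)` is continuous on `M × (M × (a, t))`. [cite: Bamler2020Entropy, §2.3] -/
theorem IsRicciFlow.continuousOn_heatKernelFn {t : ℝ} (ht : t ∈ Ioc a T) :
    ContinuousOn (fun q : M × (M × ℝ) ↦ hflow.heatKernelFn hh hR t q.1 q.2)
      (univ ×ˢ (univ ×ˢ Ioo a t)) :=
  ((hflow.heatKernelFn_spec hh hR).1 t ht).2.2.2.2.2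

/-- `(x, t) ↦ K(x,t;y,s)` is `C^∞` on `M × (s, T)`. [cite: Bamler2020Entropy, §2.3] -/
theorem IsRicciFlow.contMDiffOn_heatKernelFn_basePoint {s : ℝ} (hs : s ∈ Ioo a T) (y : M) :
    ContMDiffOn (I.prod 𝓘(ℝ, ℝ)) 𝓘(ℝ, ℝ) ∞
      (fun p : M × ℝ ↦ hflow.heatKernelFn hh hR p.2 p.1 (y, s)) (univ ×ˢ Ioo s T) :=
  ((hflow.heatKernelFn_spec hh hR).2.1 s hs y).1

/-- The heat equation `∂ₜK = Δ_{x,h(t)}K` in the base point `(x, t)`. [cite: Bamler2020Entropy, §2.3] -/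
theorem IsRicciFlow.deriv_heatKernelFn_basePoint {s : ℝ} (hs : s ∈ Ioo a T) (y : M) {p : M × ℝ}
    (hp : p ∈ (univ : Set M) ×ˢ Ioo s T) :
    deriv (fun t ↦ hflow.heatKernelFn hh hR t p.1 (y, s)) p.2 =
      (h p.2).laplaceBeltrami (fun x ↦ hflow.heatKernelFn hh hR p.2 x (y, s)) p.1 :=
  ((hflow.heatKernelFn_spec hh hR).2.1 s hs y).2 p hp

/-- `((x, t), y) ↦ K(x,t;y,s)` is continuous on `(M × (s, T]) × M`. [cite: Bamler2020Entropy, §2.3] -/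
theorem IsRicciFlow.continuousOn_heatKernelFn_basePoint {s : ℝ} (hs : s ∈ Ioo a T) :
    ContinuousOn (fun q : (M × ℝ) × M ↦ hflow.heatKernelFn hh hR q.1.2 q.1.1 (q.2, s))
      ((univ ×ˢ Ioc s T) ×ˢ univ) :=
  (hflow.heatKernelFn_spec hh hR).2.2.1 s hs

/-- Reproduction: `K(x,t;y,s) = ∫ K(z,r;y,s) dν_{x,t;r}(z)` for `a < s < r < t ≤ T`.
[cite: Bamler2020Entropy, §2.3] -/
theorem IsRicciFlow.heatKernelFn_reproduction {r t : ℝ} (har : a < r) (hrt : r < t) (htT : t ≤ T)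
    (x : M) {s : ℝ} (hs : s ∈ Ioo a r) (y : M) :
    hflow.heatKernelFn hh hR t x (y, s) =
      ∫ z, hflow.heatKernelFn hh hR r z (y, s) ∂(heatKernelMeasure hh hR t x r) :=
  ((hflow.heatKernelFn_spec hh hR).2.2.2 r t har hrt htT x s hs y).1

/-- Semigroup: `K(x,t;y,s) = ∫ K(x,t;z,r) K(z,r;y,s) dV_{h(r)}(z)` for `a < s < r < t ≤ T`.
[cite: Bamler2020Entropy, §2.3] -/
theorem IsRicciFlow.heatKernelFn_semigroup {r t : ℝ} (har : a < r) (hrt : r < t) (htT : t ≤ T)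
    (x : M) {s : ℝ} (hs : s ∈ Ioo a r) (y : M) :
    hflow.heatKernelFn hh hR t x (y, s) =
      ∫ z, hflow.heatKernelFn hh hR t x (z, r) * hflow.heatKernelFn hh hR r z (y, s)
        ∂(h r).riemVolume :=
  ((hflow.heatKernelFn_spec hh hR).2.2.2 r t har hrt htT x s hs y).2

/-- `y ↦ K(x,t;y,s)` is continuous. [cite: Bamler2020Entropy, §2.3] -/
theorem IsRicciFlow.continuous_heatKernelFn_slice {t : ℝ} (ht : t ∈ Ioc a T) (x : M) {s : ℝ}
    (hs : s ∈ Ioo a t) : Continuous fun y ↦ hflow.heatKernelFn hh hR t x (y, s) :=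
  (hflow.heatKernelFn_contMDiffOn hh hR ht x).continuousOn.comp_continuous
    (continuous_id.prodMk continuous_const) fun _ ↦ ⟨mem_univ _, hs⟩

/-- **Integration against `ν_{x,t;s}` is integration against `K(x,t;·,s) dV_{h(s)}`**:
`∫ φ dν_{x,t;s} = ∫ φ(y) K(x,t;y,s) dV_{h(s)}(y)` for every `φ : M → ℝ` (Bochner integrals; both
sides are junk `0` together when `φ` is not integrable). [cite: Bamler2020Entropy, §2.3, Def. 1] -/
theorem IsRicciFlow.integral_heatKernelMeasure_eq_integral_mul_heatKernelFn {t : ℝ} (ht : t ∈ Ioc a T)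
    (x : M) {s : ℝ} (hs : s ∈ Ioo a t) (φ : M → ℝ) :
    ∫ y, φ y ∂(heatKernelMeasure hh hR t x s) =
      ∫ y, φ y * hflow.heatKernelFn hh hR t x (y, s) ∂(h s).riemVolume := by
  rw [hflow.heatKernelMeasure_eq_withDensity_heatKernelFn hh hR ht x hs,
    integral_withDensity_eq_integral_toReal_smul
      (hflow.continuous_heatKernelFn_slice hh hR ht x hs).measurable.ennreal_ofReal
      (Eventually.of_forall fun _ ↦ ENNReal.ofReal_lt_top)]
  refine integral_congr_ae (Eventually.of_forall fun y ↦ ?_)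
  show (ENNReal.ofReal (hflow.heatKernelFn hh hR t x (y, s))).toReal • φ y = _
  rw [ENNReal.toReal_ofReal (hflow.heatKernelFn_pos hh hR ht x ⟨mem_univ _, hs⟩).le, smul_eq_mul,
    mul_comm]

/-- **Unit mass**: `∫ K(x,t;y,s) dV_{h(s)}(y) = 1`. [cite: Bamler2020Entropy, §2.3] -/
theorem IsRicciFlow.integral_heatKernelFn_eq_one {t : ℝ} (ht : t ∈ Ioc a T) (x : M) {s : ℝ}
    (hs : s ∈ Ioo a t) : ∫ y, hflow.heatKernelFn hh hR t x (y, s) ∂(h s).riemVolume = 1 := by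
  have h1 := hflow.integral_heatKernelMeasure_eq_integral_mul_heatKernelFn hh hR ht x hs fun _ ↦ 1
  simp only [one_mul, integral_const, smul_eq_mul, mul_one, probReal_univ] at h1
  exact h1.symm

end HeatKernelFnDef

end Literature.Geometry.Riemannian

end
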